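import Literature.Computability.AlgebraicComplexity.KoszulFlatteningKronecker
import Literature.LinearAlgebra.Matrix.FullRankFactorization
import HarnessLib

/-!
# Tensor powers of a rank decomposition and of its one-functional contraction (Alman–Li 2026, proof of Prop. 7.1)

Topic `Literature/Computability/AlgebraicComplexity` (family `MatrixMultiplication`). Source: J. Alman,
B. Li, *Asymptotic Rank Speedup Theorems, Revisited*, arXiv:2605.21738 (2026), §7.1, proof of
Proposition 7.1 (held text `paper:arxiv-2605.21738`, p0017 L63–83).

## The printed argument (p0017)

"**Proposition 7.1.** For any `q ≥ 2` and `n ≥ 1`, we have the tensor degeneration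
`cw_q^{⊗n} ⊕ ⟨1, (q+2)^n − 2(q+1)^n + q^n, 1⟩ ⊴ ⟨(q+2)^n⟩ ⊕ ⟨1, q^n, 1⟩`. *Proof.* Let `f` be the
linear functional on the `W`-mode given by the previous lemma. Then `M = (A ⊗ B ⊗ f)⟨q+2⟩` satisfies
`Rk(M) = q`. Tensoring these maps gives a degeneration `cw_q^{⊗n} ⊴ ⟨(q+2)^n⟩`, and `f^{⊗n}` is a
linear functional such that `M^{⊗n} = (A^{⊗n} ⊗ B^{⊗n} ⊗ f^{⊗n}) ⟨(q+2)^n⟩` has rank `q^n`.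
Applying (thm:app-oneslice) yields the desired degeneration."

## The form proved here (coordinates; the three "tensoring" facts of that proof)

For a decomposition `T = ∑_{i ∈ σ} aᵢ ⊗ bᵢ ⊗ cᵢ` in coordinates (`T a b c = ∑ᵢ A a i · B b i · C c i`,
the shape of the hypothesis of the tree's Thm. 6.1 for rank decompositions) and a functional given by
scalars `c'ᵢ` on the decomposition:

* `AlmanLi2026.kroneckerPow_eq_sum_decomposition` — "tensoring these maps": the Kronecker power
  `T^{⊠N}` (tree `kroneckerPow`, index `Fin N → ·`) carries the decomposition indexed by
  `Fin N → σ` with the product data `A^{⊗N} a f = ∏_l A (a l) (f l)` etc. (every commutative semiring).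
* `AlmanLi2026.contraction_pow_eq_powMatrix` — "`M^{⊗n} = (A^{⊗n} ⊗ B^{⊗n} ⊗ f^{⊗n})⟨r^n⟩`": the
  contraction of the product data against `c'^{⊗N}` is the tree's `powMatrix M N` of
  `M = ∑ᵢ c'ᵢ aᵢ bᵢᵀ`.
* `AlmanLi2026.rank_powMatrix_le` — "has rank `q^n`" in the form the speedup theorem consumes:
  `rank (powMatrix M N) ≤ (rank M)^N` over a field (through a rank factorization `M = G Hᵀ`, tree
  `Literature.LinearAlgebra.Matrix.exists_eq_mul_transpose_of_rank_eq`, and `powMatrix_mul`).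
* `AlmanLi2026.prod_coeff_ne_zero` — `c'^{⊗N}` is nowhere zero if `c'` is.
* `AlmanLi2026.kroneckerPow_coeff_of_lowest` — for the transfer from `K(λ)` (tree
  `AlmanLi2026Bootstrap.lean`): if a `K[λ]`-tensor `P` has `λ`-coefficients `0` below `h` and `T` at
  `h`, then `P^{⊠N}` has coefficients `0` below `N h` and `T^{⊠N}` at `N h` (the `λ`-adic lowest term
  of the tensored degeneration data).

No new definitions, no named facts.

## References

* J. Alman, B. Li, *Asymptotic Rank Speedup Theorems, Revisited*, arXiv:2605.21738 (2026), Prop. 7.1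
  and its proof (p0017). [AlmanLi2026]
-/

noncomputable section

open scoped BigOperators Matrix Polynomial

namespace Literature.Computability.AlgebraicComplexity

universe u

variable {K : Type u}
variable {ι κ μ σ : Type*}

namespace AlmanLi2026

/-! ## "Tensoring these maps": the decomposition of `T^{⊠N}` -/

/-- The Kronecker power of a decomposition `T = ∑ᵢ aᵢ ⊗ bᵢ ⊗ cᵢ` is the decomposition indexed by
`Fin N → σ` with product data ("tensoring these maps gives a degeneration `cw_q^{⊗n} ⊴ ⟨(q+2)^n⟩`").
[cite: AlmanLi2026, Prop. 7.1 (proof)] -/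
theorem kroneckerPow_eq_sum_decomposition [CommSemiring K] [Fintype σ] {T : ι → κ → μ → K}
    {A : ι → σ → K} {B : κ → σ → K} {C : μ → σ → K}
    (hT : ∀ a b c, T a b c = ∑ i, A a i * B b i * C c i) (N : ℕ) (a : Fin N → ι) (b : Fin N → κ)
    (c : Fin N → μ) :
    kroneckerPow T N a b c =
      ∑ f : Fin N → σ, (∏ l, A (a l) (f l)) * (∏ l, B (b l) (f l)) * ∏ l, C (c l) (f l) := by
  rw [kroneckerPow_apply]
  simp_rw [hT]
  rw [Fintype.prod_sum]
  refine Finset.sum_congr rfl fun f _ => ?_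
  rw [Finset.prod_mul_distrib, Finset.prod_mul_distrib]

/-- The contraction of the product data against `c'^{⊗N}` is `powMatrix M N` for
`M = ∑ᵢ c'ᵢ aᵢ bᵢᵀ` ("`M^{⊗n} = (A^{⊗n} ⊗ B^{⊗n} ⊗ f^{⊗n})⟨(q+2)^n⟩`").
[cite: AlmanLi2026, Prop. 7.1 (proof)] -/
theorem contraction_pow_eq_powMatrix [CommRing K] [Fintype σ] (A : ι → σ → K) (B : κ → σ → K)
    (c' : σ → K) (N : ℕ) :
    (Matrix.of fun (a : Fin N → ι) (b : Fin N → κ) =>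
        ∑ f : Fin N → σ, (∏ l, A (a l) (f l)) * (∏ l, B (b l) (f l)) * ∏ l, c' (f l)) =
      powMatrix (Matrix.of fun a b => ∑ i, A a i * B b i * c' i) N := by
  ext a b
  rw [Matrix.of_apply, powMatrix_apply]
  simp only [Matrix.of_apply]
  rw [Fintype.prod_sum]
  refine Finset.sum_congr rfl fun f _ => ?_
  rw [Finset.prod_mul_distrib, Finset.prod_mul_distrib]

/-- `c'^{⊗N}` is nowhere zero when `c'` is ("nonzero scalars"). [cite: AlmanLi2026, Prop. 7.1 (proof)] -/
theorem prod_coeff_ne_zero [CommMonoidWithZero K] [NoZeroDivisors K] [Nontrivial K] {c' : σ → K}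
    (hc' : ∀ i, c' i ≠ 0) {N : ℕ} (f : Fin N → σ) : (∏ l, c' (f l)) ≠ 0 :=
  Finset.prod_ne_zero_iff.2 fun l _ => hc' (f l)

/-! ## "has rank `q^n`": `rank (M^{⊗N}) ≤ (rank M)^N` -/

/-- **Rank of a Kronecker power**: `rank (powMatrix M N) ≤ (rank M)^N` over a field — through a rank
factorization `M = G Hᵀ` with inner dimension `rank M`, `M^{⊗N} = G^{⊗N} (Hᵀ)^{⊗N}` factors through
`K^{(rank M)^N}`. (The printed "has rank `q^n`" is used by the speedup theorem only as "rank at most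
`q^n`".) [cite: AlmanLi2026, Prop. 7.1 (proof)] -/
theorem rank_powMatrix_le [Field K] [Fintype ι] [Fintype κ] [DecidableEq ι] [DecidableEq κ]
    (M : Matrix ι κ K) (N : ℕ) : (powMatrix M N).rank ≤ M.rank ^ N := by
  classical
  obtain ⟨G, H, hGH⟩ :=
    Literature.LinearAlgebra.Matrix.exists_eq_mul_transpose_of_rank_eq M rfl
  have hpow : powMatrix M N = powMatrix G N * powMatrix Hᵀ N := by
    rw [powMatrix_mul, ← hGH]
  rw [hpow]
  calc (powMatrix G N * powMatrix Hᵀ N).rank ≤ (powMatrix G N).rank := Matrix.rank_mul_le_left _ _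
    _ ≤ Fintype.card (Fin N → Fin M.rank) := Matrix.rank_le_card_width _
    _ = M.rank ^ N := by rw [Fintype.card_fun, Fintype.card_fin, Fintype.card_fin]

/-! ## The `λ`-adic lowest term of a tensored family (for the transfer `K(λ) → K`) -/

/-- Lowest coefficients multiply: if `p ≡ c₁ λ^{h₁}` and `q ≡ c₂ λ^{h₂}` to their respective orders,
then `p q ≡ c₁c₂ λ^{h₁+h₂}`. [folklore] -/
private theorem coeff_mul_of_lowest₂ [CommSemiring K] {p q : K[X]} {c₁ c₂ : K} {h₁ h₂ : ℕ}
    (hp : ∀ j ≤ h₁, p.coeff j = if j = h₁ then c₁ else 0)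
    (hq : ∀ j ≤ h₂, q.coeff j = if j = h₂ then c₂ else 0) {i : ℕ} (hi : i ≤ h₁ + h₂) :
    (p * q).coeff i = if i = h₁ + h₂ then c₁ * c₂ else 0 := by
  rw [Polynomial.coeff_mul]
  by_cases hieq : i = h₁ + h₂
  · rw [if_pos hieq, Finset.sum_eq_single (h₁, h₂)]
    · rw [hp h₁ le_rfl, hq h₂ le_rfl, if_pos rfl, if_pos rfl]
    · rintro ⟨x₁, x₂⟩ hx hne
      rw [Finset.HasAntidiagonal.mem_antidiagonal] at hx
      simp only at hx
      by_cases hx₁ : x₁ ≤ h₁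
      · have hx₁' : x₁ ≠ h₁ := by
          rintro rfl
          apply hne
          have : x₂ = h₂ := by omega
          rw [this]
        rw [hp x₁ hx₁, if_neg hx₁', zero_mul]
      · have hx₂ : x₂ ≤ h₂ := by omega
        have hx₂' : x₂ ≠ h₂ := by omega
        rw [hq x₂ hx₂, if_neg hx₂', mul_zero]
    · intro h
      exact absurd (Finset.HasAntidiagonal.mem_antidiagonal.2 hieq.symm) h
  · rw [if_neg hieq]
    refine Finset.sum_eq_zero ?_
    rintro ⟨x₁, x₂⟩ hx
    rw [Finset.HasAntidiagonal.mem_antidiagonal] at hx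
    simp only at hx
    by_cases hx₁ : x₁ ≤ h₁
    · by_cases hx₁' : x₁ = h₁
      · have hx₂ : x₂ ≤ h₂ := by omega
        have hx₂' : x₂ ≠ h₂ := by omega
        rw [hq x₂ hx₂, if_neg hx₂', mul_zero]
      · rw [hp x₁ hx₁, if_neg hx₁', zero_mul]
    · have hx₂ : x₂ ≤ h₂ := by omega
      have hx₂' : x₂ ≠ h₂ := by omega
      rw [hq x₂ hx₂, if_neg hx₂', mul_zero]

/-- Lowest coefficient of a finite product of polynomials with prescribed lowest terms at a common
order `h`: order `N h`, coefficient the product. [folklore] -/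
private theorem coeff_prod_of_lowest [CommSemiring K] {h : ℕ} :
    ∀ (N : ℕ) (p : Fin N → K[X]) (c : Fin N → K),
      (∀ l, ∀ j ≤ h, (p l).coeff j = if j = h then c l else 0) →
        ∀ i ≤ N * h, (∏ l, p l).coeff i = if i = N * h then ∏ l, c l else 0
  | 0, p, c, _, i, hi => by
      have hi0 : i = 0 := by omega
      subst hi0
      simp
  | N + 1, p, c, hp, i, hi => by
      rw [Fin.prod_univ_succ, Fin.prod_univ_succ]
      have hrest := coeff_prod_of_lowest N (fun l => p l.succ) (fun l => c l.succ)
        (fun l => hp l.succ)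
      have hmul := coeff_mul_of_lowest₂ (hp 0) (h₂ := N * h) (c₂ := ∏ l : Fin N, c l.succ)
        (fun j hj => hrest j hj) (i := i) (by rw [Nat.succ_mul] at hi; omega)
      rw [hmul]
      have e : h + N * h = (N + 1) * h := by ring
      rw [e]

/-- **The `λ`-adic lowest term of a Kronecker power**: if the `K[λ]`-tensor `P` has `λ`-coefficients
`0` below `h` and `T` at `h` (`P = λ^h T + O(λ^{h+1})`), then `P^{⊠N} = λ^{Nh} T^{⊠N} + O(λ^{Nh+1})`
coefficientwise — the lowest-order term of the tensored degeneration data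
("tensoring these maps gives a degeneration `cw_q^{⊗n} ⊴ ⟨(q+2)^n⟩`", read over `K(λ)` and pulled
back by `AlmanLi2026Bootstrap`). [cite: AlmanLi2026, Prop. 7.1 (proof)] -/
theorem kroneckerPow_coeff_of_lowest [CommSemiring K] {P : ι → κ → μ → K[X]} {T : ι → κ → μ → K}
    {h : ℕ} (hP : ∀ a b c, ∀ j ≤ h, (P a b c).coeff j = if j = h then T a b c else 0) (N : ℕ)
    (a : Fin N → ι) (b : Fin N → κ) (c : Fin N → μ) :
    ∀ j ≤ N * h, (kroneckerPow P N a b c).coeff j =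
      if j = N * h then kroneckerPow T N a b c else 0 := by
  intro j hj
  rw [kroneckerPow_apply, kroneckerPow_apply]
  exact coeff_prod_of_lowest N (fun l => P (a l) (b l) (c l)) (fun l => T (a l) (b l) (c l))
    (fun l => hP (a l) (b l) (c l)) j hj

end AlmanLi2026

end Literature.Computability.AlgebraicComplexity
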